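import Literature.MathematicalPhysics.QuantumFieldTheory.Balaban1983to89.B13CoerciveOfInverseFormBound
import Literature.MathematicalPhysics.QuantumFieldTheory.Balaban1983to89.B13AccretiveOfRealCoercive

/-!
# `Balaban1983to89.B13CoerciveAlongPencil` — T. Bałaban, *Propagators for lattice gauge theories in a background field*, Commun. Math. Phys. **99** (1985)
# 389–434 [Balaban1985BackgroundPropagators], Thm 3.4 p. 400 («In fact we prove quantitative statements which are more precise, describing these analytic
# extensions as small perturbations of the operators depending on U only»), Sect. B (3.62)–(3.64) p. 402, (3.84)–(3.86) p. 407, Thm 3.10 (3.107)–(3.108)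
# p. 416, Thm 3.11 p. 416 («the operators Δ′_a, G′, (Q′G′²Q′*)⁻¹, Δ_a, G are positive definite»); [Balaban1988RG2Cluster] p. 15 («For the pair (U, 0) the
# operators are symmetric, and the measure is positive … The general case is handled by a perturbative argument»):
# ★★★ THEOREM 3.11's CLAUSE IS OPEN ALONG pv27's PENCIL, WITH A LOCATED RADIUS — the quantitative coercivity of a holomorphic operator family at the
# centre of its chart ball PROPAGATES to the whole concentric ball of radius `R′`, losing `2·S·R′∕R` (`S` = the absolute row ∕ column sum of the (3.108)-type
# majorant of the family's product-basis matrix), by the Schwarz lemma (entry deviation) and a Schur bound; hence, at def-Y's letters, `Δ_a(e^{iηA′}U₀)` is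
# coercive — in particular positive definite — for every `A′` in a located ball around a background `U₀` where it is coercive (e.g. where Theorem 3.11's
# clause and Theorem 3.3's (3.46)–(3.47) hold, module `B13CoerciveOfInverseFormBound`).

[folklore] finite-dimensional form algebra (a Schur bound for the real part of a complex quadratic form) + the lane's Schwarz-deviation lemma
(`B13AccretiveOfRealCoercive.norm_entry_sub_zero_le`, over Mathlib's `Complex.dist_le_div_mul_dist_of_mapsTo_ball`) + n10-w2's product-basis dictionary
(`B13GreenCentreDecayOfCoercive.weightedForm_toMatrix_eq_trIP`) + compositions BY NAME; THEOREMS ONLY (no `def`, no `structure`, no instance, no notation);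
NOTHING of NODE 00's ∕ N06's is modified or restated; nothing here is a claim about the Yang–Mills mass gap; no node is discharged; count-neutral.

WHY THIS FILE (cell `pub-ymgap`, HUMAN RULING D-0062, Track A node N10 = [B13]; seat `pub-ymgap-dag-n10-c` g16, the N10 LANE OWNER, module 83, CLAIM-2 ∕ INTENT-2
2026-08-28).  Row 17 of the N06 certificate displays Theorem 3.11's clause `PosDefTr 1 (Δ_a(U))` per member; the director's STANDING A6 RULE (№189 (3)) asks for
NAMED INHABITANTS of such binders.  The tree's inhabitants so far are the PURE GAUGES `1^u` (n06-j `B9Thm311DeltaAGaugeOrbit.posDefTr_deltaAY_parSymY_pureGauge`,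
`B9Thm311CoercivePureGaugeAtLettersY`) — a measure-zero class — and the clause FAILS on other gauge orbits (`…not_posDefTr_deltaAY_parSymY_gaugeY_frustCfg`).  THIS
FILE types print's «perturbative argument» ([II] p. 15 ∕ [B9] Thm 3.4) in the N10 lane's entry-letter currency: along pv27's pencil `A′ ↦ e^{iηA′}U₀` the
coercivity constant of `Δ_a` at the centre degrades at most linearly in the radius, at a rate located by the (3.108)-letters `(R, ρ, B_Δ)` of Δ_a's pencil
family (the junction's own datum — the lane's local part + the width seats' `D R D*` station) and a fibre bound of the location map.  Consequences: (a) the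
clause holds on the OPEN located ball `‖A′‖ < R′`, `2·B_Δ·(m_F·c₀(1,ρ)^ν)·R′ < m·R`, around every coercive centre — an open inhabitant class for row 17 once
ONE centre is supplied (at `U₀ = 1` the centre is n06-j's `exists_coer_deltaAY_parSymY_one`); (b) combined with module 82 (`hco` at `U₀` from Theorem 3.11's
clause + Theorem 3.3's (3.46)–(3.47) for `G`), print's two statements AT ONE BACKGROUND give the quantitative clause on the whole located ball around it.

WHAT THIS FILE PROVES (all `theorem`s; `B′` = the product basis `(Pi.basis fun _ => Matrix.stdBasis ℂ (Fin N) (Fin N)).reindex (Equiv.sigmaEquivProd S (Fin N × Fin N))`).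
* §1 (ANY finite `q`) `abs_re_form_le_of_rowSum_colSum` — the Schur bound `|Re Σ v̄_i (P v)_i| ≤ p·Σ‖v_i‖²` from absolute row ∕ column sums `≤ p` (public twin
  of the private lemma inside `B13Sqrt27Accretive`, over `Literature.Analysis.Matrix`).
* §2 (ANY finite `S`, fibre `M_N(ℂ)`, flat trace pairing `trIP 1`) `trIP_one_apply_eq_re_form_toMatrix` ∕ `trIP_one_self_eq_sum_norm_sq` (n10-w2's dictionary read
  at a field `Ψ` rather than at coordinates `v`); ★ `abs_trIP_sub_le_of_rowSum_colSum` (`|⟨Ψ,TΨ⟩₁ − ⟨Ψ,T₀Ψ⟩₁| ≤ ℓ·⟨Ψ,Ψ⟩₁` when `toMatrix B′ B′ (T − T₀)` has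
  absolute row ∕ column sums `≤ ℓ`); ★ `coer_of_coer_of_rowSum_colSum` (`m·⟨Ψ,Ψ⟩₁ ≤ ⟨Ψ,T₀Ψ⟩₁` ⟹ `(m − ℓ)·⟨Ψ,Ψ⟩₁ ≤ ⟨Ψ,TΨ⟩₁`); `posDefTr_one_of_coer`
  (`0 < m` coercive ⟹ `PosDefTr 1`).
* §3 (a holomorphic family `T : E → Module.End ℂ (S → M_N(ℂ))` on a complex chart `E`, torus locations `loc`) ★★ `coer_ball_of_coer_centre_letters`:
  `RawEntryLetters (u ↦ toMatrix B′ B′ (T u)) loc R ρ B` (`0 < ρ`), a fibre bound `m_F` of `loc`, `m·⟨Ψ,Ψ⟩₁ ≤ ⟨Ψ, T(0)Ψ⟩₁`, `0 ≤ R′ ≤ R` ⟹ for every `‖u‖ < R′`,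
  `(m − 2·(B·(m_F·c₀(1,ρ)^ν))·R′∕R)·⟨Ψ,Ψ⟩₁ ≤ ⟨Ψ, T(u)Ψ⟩₁`; ★★ `posDefTr_ball_of_coer_centre_letters` (the clause `PosDefTr 1 (T u)` on the located ball
  `2·(B·(m_F·c₀(1,ρ)^ν))·R′ < m·R`).
* §4 (NODE 00's `Δ_a` at ANY letters `parS parB Gp`, along pv27's pencil `prodCfg U₀ η`) ★★★ `trIP_deltaAY_prodCfg_ge_of_coer_centre` and
  ★★★ `posDefTr_deltaAY_prodCfg_of_coer_centre` (§3 at `T u := Δ_a(e^{iηu}U₀)`, `prodCfg_zero`): THEOREM 3.11's CLAUSE ON THE LOCATED BALL AROUND A COERCIVE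
  BACKGROUND; ★★★ `posDefTr_deltaAY_parSymY_gaugeY_prodCfg_of_coer_centre` (v4 letters: the clause on the GAUGE ORBIT of the located ball, (3.34) by n06-j's
  `posDefTr_deltaAY_parSymY_gaugeY_iff` — an open gauge-invariant inhabitant class); ★★★ `posDefTr_deltaAY_parSymY_prodCfg_of_posDefTr_of_GAY_formBound` (v4
  letters, `G ≤ U(N)`, `G`-valued `U₀`): the centre's `hco` SUPPLIED by module 82
  from Theorem 3.11's clause + Theorem 3.3's (3.46)–(3.47) at `U₀` — print's two statements at ONE background give the clause on the located ball
  `2·(B_Δ·(m_F·c₀(1,ρ)^ν))·R′ < B⁻¹·R`.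

HONEST FRAMING: [folklore] bookkeeping + compositions; Δ_a's pencil letters `hA`, the centre's coercivity (or Theorem 3.11's clause + (3.46)–(3.47) at the centre)
are DISPLAYED — N06's ∕ the junction's, NOT proved here; the ball is in the CHART (globally small `A′` around `U₀`), NOT print's class (3.35) (which is only
locally gauge-small: the passage from charts to (3.35) is print's random-walk gluing (3.105)–(3.108), N06's, untouched); finite-lattice constants, not print's
`O(1)`; nothing of Bałaban's asserted beyond the cited theorems; N06 ∕ N10 NOT discharged; K1⁹ NOT closed; counts unmoved (typed 28∕28 · discharged 5∕27);
0 `def`, 0 `sorry`, standard axioms; one finite 𝕋⁴ programme at fixed ε — R4 closes the conditional finite-𝕋⁴ rung `BalabanLadder.UV` only; the YM mass gap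
(Clay) is NOT proved by any of this; nothing continuum ∕ ℝ⁴ ∕ OS.  Filed `--kind proof --supports` K1⁹ (stmt-QuantumFields-27364), Literature lane.

References: T. Bałaban, CMP 99 (1985) 389–434 [Balaban1985BackgroundPropagators] (3.26)–(3.27) p.395, (3.35) p.396, Thm 3.3 p.399, (3.46)–(3.47) p.398, Thm 3.4 p.400,
(3.62)–(3.64) p.402, (3.84)–(3.86) p.407, Thm 3.10 (3.107)–(3.108) pp.415–416, Thm 3.11 p.416; CMP 116 (1988) 1–22 [Balaban1988RG2Cluster] (2.5)–(2.7) pp.12–13,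
p.15, (2.16) p.16; CMP 96 (1984) 223–250 [Balaban1984PropagatorsII] p.226, (2.52) p.232, Lemma 2.1 (2.61) p.234.
-/

noncomputable section

namespace Literature.MathematicalPhysics.QuantumFieldTheory.Balaban1983to89.B13CoerciveAlongPencil

open Metric Set Finset Module
open scoped Matrix Matrix.Norms.L2Operator
open Literature.MathematicalPhysics.QuantumFieldTheory.Balaban1983to89
open Literature.MathematicalPhysics.QuantumFieldTheory.Balaban1983to89.B9Thm37GlueTorus (tdist1)
open Literature.MathematicalPhysics.QuantumFieldTheory.Balaban1983to89.B5TorusCover (UT)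
open Literature.MathematicalPhysics.QuantumFieldTheory.Balaban1983to89.B9Thm311ReadingCoords (trIP PosDefTr norm_sq_realify311)
open Literature.MathematicalPhysics.QuantumFieldTheory.Balaban1983to89.B13EntrywiseWalks (RawEntryLetters)
open Literature.MathematicalPhysics.QuantumFieldTheory.Balaban1983to89.B13GreenCentreDecayOfCoercive (weightedForm_toMatrix_eq_trIP weightedNormSq_eq_trIP)
open Literature.MathematicalPhysics.QuantumFieldTheory.Balaban1983to89.B13AccretiveOfRealCoercive (norm_entry_sub_zero_le rowSum_decay_le colSum_decay_le)
open Literature.MathematicalPhysics.QuantumFieldTheory.Balaban1983to89.B13LocalKernelWalks (rowSum_torus)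
open Literature.MathematicalPhysics.QuantumFieldTheory.Balaban1983to89.B13CoerciveOfInverseFormBound (trIP_deltaAY_parSymY_ge_of_posDefTr_of_GAY_formBound)
open Literature.MathematicalPhysics.QuantumFieldTheory.Balaban1983to89.B9Eq39Adjoint (prodCfg)
open Literature.MathematicalPhysics.QuantumFieldTheory.Balaban1983to89.B9Eq369Product (prodCfg_zero)
open Literature.MathematicalPhysics.QuantumFieldTheory.Balaban1983to89.B6GlobalChartV1 (PV)
open Literature.MathematicalPhysics.QuantumFieldTheory.Balaban1983to89.B6KLevelCensusIndexV1 (KIdx)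
open Literature.MathematicalPhysics.QuantumFieldTheory.Balaban1983to89.Node00

/-! ## §1. The Schur bound for the real part of a complex quadratic form -/

section Schur

variable {q : Type} [Fintype q]

/-- **SCHUR BOUND**: if the absolute row and column sums of `P` are `≤ p` then `|Re Σ_i v̄_i (P v)_i| ≤ p·Σ_i ‖v_i‖²` (Cauchy–Schwarz + the Schur test
`Σ‖(Pv)_i‖² ≤ p²·Σ‖v_i‖²` of `Literature.Analysis.Matrix`). [cite: Balaban1984PropagatorsII, Lemma 2.1 (2.61) p.234; Balaban1988RG2Cluster, p.15, (2.16) p.16; folklore] -/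
theorem abs_re_form_le_of_rowSum_colSum (P : Matrix q q ℂ) {p : ℝ} (hp : 0 ≤ p)
    (hrow : ∀ i, ∑ j, ‖P i j‖ ≤ p) (hcol : ∀ j, ∑ i, ‖P i j‖ ≤ p) (v : q → ℂ) :
    |(∑ i, star (v i) * (P *ᵥ v) i).re| ≤ p * ∑ i, ‖v i‖ ^ 2 := by
  set T : ℝ := ∑ i, ‖v i‖ ^ 2 with hT
  have hT0 : 0 ≤ T := Finset.sum_nonneg fun i _ => by positivity
  have h1 : |(∑ i, star (v i) * (P *ᵥ v) i).re| ≤ ‖star v ⬝ᵥ (P *ᵥ v)‖ :=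
    (Complex.abs_re_le_norm _).trans_eq rfl
  have h2 := Literature.Analysis.Matrix.norm_star_dotProduct_le_sqrt_mul_sqrt v (P *ᵥ v)
  have h3 := Literature.Analysis.Matrix.sum_norm_sq_mulVec_le_of_rowSum_le_of_colSum_le P hp hrow hcol v
  have h4 : Real.sqrt (∑ i, ‖(P *ᵥ v) i‖ ^ 2) ≤ p * Real.sqrt T := by
    rw [← Real.sqrt_sq hp, ← Real.sqrt_mul (sq_nonneg p)]
    exact Real.sqrt_le_sqrt (by nlinarith [h3])
  calc |(∑ i, star (v i) * (P *ᵥ v) i).re| ≤ Real.sqrt T * Real.sqrt (∑ i, ‖(P *ᵥ v) i‖ ^ 2) := h1.trans h2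
    _ ≤ Real.sqrt T * (p * Real.sqrt T) := mul_le_mul_of_nonneg_left h4 (Real.sqrt_nonneg _)
    _ = p * T := by rw [mul_left_comm, Real.mul_self_sqrt hT0]

end Schur

/-! ## §2. The flat trace pairing read in the product basis; coercivity under a Schur-small deviation -/

section Trace

variable {S : Type} [Fintype S] [DecidableEq S] {N : ℕ}

/-- the flat trace form of `T` at `Ψ` IS the real part of the product-basis quadratic form at the entries of `Ψ` (n10-w2's `weightedForm_toMatrix_eq_trIP` at
`w = 1`, read at a field). [cite: Balaban1985BackgroundPropagators, p.393 (scalar products), (3.107) p.416; dictionary] -/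
theorem trIP_one_apply_eq_re_form_toMatrix (T : Module.End ℂ (S → Matrix (Fin N) (Fin N) ℂ)) (Ψ : S → Matrix (Fin N) (Fin N) ℂ) :
    trIP (fun _ => (1 : ℝ)) Ψ (T Ψ) =
      (∑ p, star ((fun p : S × (Fin N × Fin N) => Ψ p.1 p.2.1 p.2.2) p) *
        (LinearMap.toMatrix ((Pi.basis fun _ : S => Matrix.stdBasis ℂ (Fin N) (Fin N)).reindex (Equiv.sigmaEquivProd S (Fin N × Fin N)))
          ((Pi.basis fun _ : S => Matrix.stdBasis ℂ (Fin N) (Fin N)).reindex (Equiv.sigmaEquivProd S (Fin N × Fin N))) T *ᵥ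
            (fun p : S × (Fin N × Fin N) => Ψ p.1 p.2.1 p.2.2)) p).re := by
  have h := weightedForm_toMatrix_eq_trIP (fun _ : S => (1 : ℝ)) T (fun p : S × (Fin N × Fin N) => Ψ p.1 p.2.1 p.2.2)
  simp only [Complex.ofReal_one, one_mul] at h
  exact h.symm

omit [DecidableEq S] in
/-- … and `⟨Ψ,Ψ⟩₁` is the sum of the squared entry moduli. [cite: Balaban1985BackgroundPropagators, p.393 (scalar products); dictionary] -/
theorem trIP_one_self_eq_sum_norm_sq (Ψ : S → Matrix (Fin N) (Fin N) ℂ) :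
    trIP (fun _ => (1 : ℝ)) Ψ Ψ = ∑ p, ‖(fun p : S × (Fin N × Fin N) => Ψ p.1 p.2.1 p.2.2) p‖ ^ 2 := by
  have h := weightedNormSq_eq_trIP (fun _ : S => (1 : ℝ)) (fun p : S × (Fin N × Fin N) => Ψ p.1 p.2.1 p.2.2)
  simp only [one_mul] at h
  exact h.symm

/-- ★ **A SCHUR-SMALL DEVIATION MOVES THE FORM BY AT MOST `ℓ·⟨Ψ,Ψ⟩₁`**: if the product-basis matrix of `T − T₀` has absolute row and column sums `≤ ℓ` then
`|⟨Ψ,TΨ⟩₁ − ⟨Ψ,T₀Ψ⟩₁| ≤ ℓ·⟨Ψ,Ψ⟩₁`. [cite: Balaban1985BackgroundPropagators, Thm 3.4 p.400, (3.62)–(3.64) p.402; Balaban1988RG2Cluster, p.15, (2.16) p.16; folklore] -/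
theorem abs_trIP_sub_le_of_rowSum_colSum (T T₀ : Module.End ℂ (S → Matrix (Fin N) (Fin N) ℂ)) {ℓ : ℝ} (hℓ : 0 ≤ ℓ)
    (hrow : ∀ p, ∑ q, ‖LinearMap.toMatrix ((Pi.basis fun _ : S => Matrix.stdBasis ℂ (Fin N) (Fin N)).reindex (Equiv.sigmaEquivProd S (Fin N × Fin N)))
        ((Pi.basis fun _ : S => Matrix.stdBasis ℂ (Fin N) (Fin N)).reindex (Equiv.sigmaEquivProd S (Fin N × Fin N))) (T - T₀) p q‖ ≤ ℓ)
    (hcol : ∀ q, ∑ p, ‖LinearMap.toMatrix ((Pi.basis fun _ : S => Matrix.stdBasis ℂ (Fin N) (Fin N)).reindex (Equiv.sigmaEquivProd S (Fin N × Fin N)))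
        ((Pi.basis fun _ : S => Matrix.stdBasis ℂ (Fin N) (Fin N)).reindex (Equiv.sigmaEquivProd S (Fin N × Fin N))) (T - T₀) p q‖ ≤ ℓ)
    (Ψ : S → Matrix (Fin N) (Fin N) ℂ) :
    |trIP (fun _ => (1 : ℝ)) Ψ (T Ψ) - trIP (fun _ => (1 : ℝ)) Ψ (T₀ Ψ)| ≤ ℓ * trIP (fun _ => (1 : ℝ)) Ψ Ψ := by
  have hsub : trIP (fun _ => (1 : ℝ)) Ψ (T Ψ) - trIP (fun _ => (1 : ℝ)) Ψ (T₀ Ψ) = trIP (fun _ => (1 : ℝ)) Ψ ((T - T₀) Ψ) := by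
    rw [trIP_one_apply_eq_re_form_toMatrix, trIP_one_apply_eq_re_form_toMatrix, trIP_one_apply_eq_re_form_toMatrix, map_sub,
      Matrix.sub_mulVec, ← Complex.sub_re, ← Finset.sum_sub_distrib]
    refine congrArg Complex.re (Finset.sum_congr rfl fun p _ => ?_)
    rw [Pi.sub_apply, mul_sub]
  rw [hsub, trIP_one_apply_eq_re_form_toMatrix, trIP_one_self_eq_sum_norm_sq]
  exact abs_re_form_le_of_rowSum_colSum _ hℓ hrow hcol _

/-- ★ **COERCIVITY UNDER A SCHUR-SMALL DEVIATION**: `m·⟨Ψ,Ψ⟩₁ ≤ ⟨Ψ,T₀Ψ⟩₁` and row ∕ column sums `≤ ℓ` for the matrix of `T − T₀` ⟹ `(m − ℓ)·⟨Ψ,Ψ⟩₁ ≤ ⟨Ψ,TΨ⟩₁`.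
[cite: Balaban1985BackgroundPropagators, Thm 3.4 p.400, Thm 3.11 p.416; Balaban1988RG2Cluster, p.15; folklore] -/
theorem coer_of_coer_of_rowSum_colSum (T T₀ : Module.End ℂ (S → Matrix (Fin N) (Fin N) ℂ)) {m ℓ : ℝ} (hℓ : 0 ≤ ℓ)
    (hco : ∀ Ψ : S → Matrix (Fin N) (Fin N) ℂ, m * trIP (fun _ => (1 : ℝ)) Ψ Ψ ≤ trIP (fun _ => (1 : ℝ)) Ψ (T₀ Ψ))
    (hrow : ∀ p, ∑ q, ‖LinearMap.toMatrix ((Pi.basis fun _ : S => Matrix.stdBasis ℂ (Fin N) (Fin N)).reindex (Equiv.sigmaEquivProd S (Fin N × Fin N)))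
        ((Pi.basis fun _ : S => Matrix.stdBasis ℂ (Fin N) (Fin N)).reindex (Equiv.sigmaEquivProd S (Fin N × Fin N))) (T - T₀) p q‖ ≤ ℓ)
    (hcol : ∀ q, ∑ p, ‖LinearMap.toMatrix ((Pi.basis fun _ : S => Matrix.stdBasis ℂ (Fin N) (Fin N)).reindex (Equiv.sigmaEquivProd S (Fin N × Fin N)))
        ((Pi.basis fun _ : S => Matrix.stdBasis ℂ (Fin N) (Fin N)).reindex (Equiv.sigmaEquivProd S (Fin N × Fin N))) (T - T₀) p q‖ ≤ ℓ)
    (Ψ : S → Matrix (Fin N) (Fin N) ℂ) :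
    (m - ℓ) * trIP (fun _ => (1 : ℝ)) Ψ Ψ ≤ trIP (fun _ => (1 : ℝ)) Ψ (T Ψ) := by
  have h := abs_trIP_sub_le_of_rowSum_colSum T T₀ hℓ hrow hcol Ψ
  have h' := neg_le_of_abs_le h
  have h0 := hco Ψ
  rw [sub_mul]
  linarith

omit [DecidableEq S] in
/-- a coercive operator with a positive constant is positive definite for the flat trace pairing. [cite: Balaban1985BackgroundPropagators, Thm 3.11 p.416; folklore] -/
theorem posDefTr_one_of_coer (T : Module.End ℂ (S → Matrix (Fin N) (Fin N) ℂ)) {m : ℝ} (hm : 0 < m)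
    (hco : ∀ Ψ : S → Matrix (Fin N) (Fin N) ℂ, m * trIP (fun _ => (1 : ℝ)) Ψ Ψ ≤ trIP (fun _ => (1 : ℝ)) Ψ (T Ψ)) :
    PosDefTr (fun _ => (1 : ℝ)) T := by
  intro Φ hΦ
  have hpos : 0 < trIP (fun _ => (1 : ℝ)) Φ Φ := by
    rw [← norm_sq_realify311 (w := fun _ => (1 : ℝ)) (hw := fun _ => one_pos)]
    have hne : B9Thm311ReadingCoords.realify311 (fun _ => (1 : ℝ)) (fun _ => one_pos) Φ ≠ 0 :=
      fun h0 => hΦ ((LinearEquiv.map_eq_zero_iff _).mp h0)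
    positivity
  exact lt_of_lt_of_le (mul_pos hm hpos) (hco Φ)

end Trace

/-! ## §3. ★★ Coercivity propagates from the centre to the whole concentric chart ball (holomorphic families with (3.108)-letters) -/

section Ball

variable {S : Type} [Fintype S] [DecidableEq S] {N : ℕ}
variable {ν : ℕ} {Nf : Fin ν → ℕ} [∀ j, NeZero (Nf j)]
variable {E : Type*} [NormedAddCommGroup E] [NormedSpace ℂ E]

/-- ★★ **COERCIVITY ON THE BALL FROM COERCIVITY AT THE CENTRE** ([B9] Thm 3.4's «small perturbations of the operators depending on U only»; [II] p. 15's
«perturbative argument»).  Let `T : E → Module.End ℂ (S → M_N(ℂ))` have product-basis matrices with the letters `RawEntryLetters (u ↦ toMatrix B′ B′ (T u)) loc R ρ B`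
(entrywise holomorphy + decay `B·e^{−ρ d₁}` on `‖u‖ < R`, `0 < ρ`), `loc` with fibres `≤ m_F`, and let `T 0` be coercive: `m·⟨Ψ,Ψ⟩₁ ≤ ⟨Ψ, T(0)Ψ⟩₁`.  Then for
`0 ≤ R′ ≤ R` and every `‖u‖ < R′`: `(m − 2·(B·(m_F·c₀(1,ρ)^ν))·R′∕R)·⟨Ψ,Ψ⟩₁ ≤ ⟨Ψ, T(u)Ψ⟩₁` — Schwarz deviation `‖M(u)_{pq} − M(0)_{pq}‖ ≤ 2B e^{−ρd}·R′∕R`, its row ∕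
column sums by the fibre bound and the torus row sum `c₀(1,ρ)^ν`, then §2.
[cite: Balaban1985BackgroundPropagators, Thm 3.4 p.400, (3.62)–(3.64) p.402, Thm 3.10 (3.108) p.416, Thm 3.11 p.416; Balaban1988RG2Cluster, p.15, (2.16) p.16;
Balaban1984PropagatorsII, Lemma 2.1 (2.61) p.234] -/
theorem coer_ball_of_coer_centre_letters (T : E → Module.End ℂ (S → Matrix (Fin N) (Fin N) ℂ)) {loc : S × (Fin N × Fin N) → UT Nf} {R R' ρ B m : ℝ}
    (hA : RawEntryLetters (fun u => LinearMap.toMatrix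
        ((Pi.basis fun _ : S => Matrix.stdBasis ℂ (Fin N) (Fin N)).reindex (Equiv.sigmaEquivProd S (Fin N × Fin N)))
        ((Pi.basis fun _ : S => Matrix.stdBasis ℂ (Fin N) (Fin N)).reindex (Equiv.sigmaEquivProd S (Fin N × Fin N))) (T u)) loc R ρ B)
    (hρ : 0 < ρ) {mF : ℕ} (hfib : ∀ y : UT Nf, (univ.filter fun k => loc k = y).card ≤ mF)
    (hco : ∀ Ψ : S → Matrix (Fin N) (Fin N) ℂ, m * trIP (fun _ => (1 : ℝ)) Ψ Ψ ≤ trIP (fun _ => (1 : ℝ)) Ψ (T 0 Ψ))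
    (hR' : 0 ≤ R') (hR'R : R' ≤ R) :
    ∀ u ∈ ball (0 : E) R', ∀ Ψ : S → Matrix (Fin N) (Fin N) ℂ,
      (m - 2 * (B * (mF * B6.c0 1 ρ ^ ν)) * R' / R) * trIP (fun _ => (1 : ℝ)) Ψ Ψ ≤ trIP (fun _ => (1 : ℝ)) Ψ (T u Ψ) := by
  intro u hu Ψ
  have hR0 : 0 ≤ R := hR'.trans hR'R
  -- Schwarz deviation of every entry from the centre
  have hdev := norm_entry_sub_zero_le hA.holo hA.decay hR'R u hu
  -- the deviation's row and column sums
  have hS0 : 0 ≤ B * (mF * B6.c0 1 ρ ^ ν) := mul_nonneg hA.B_nonneg (mul_nonneg (Nat.cast_nonneg _) (pow_nonneg (B6RandomWalk.c0_nonneg 1 ρ) ν))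
  have hℓ : 0 ≤ 2 * (B * (mF * B6.c0 1 ρ ^ ν)) * R' / R := by positivity
  have hmat : ∀ p q, LinearMap.toMatrix
        ((Pi.basis fun _ : S => Matrix.stdBasis ℂ (Fin N) (Fin N)).reindex (Equiv.sigmaEquivProd S (Fin N × Fin N)))
        ((Pi.basis fun _ : S => Matrix.stdBasis ℂ (Fin N) (Fin N)).reindex (Equiv.sigmaEquivProd S (Fin N × Fin N))) (T u - T 0) p q =
      LinearMap.toMatrix
        ((Pi.basis fun _ : S => Matrix.stdBasis ℂ (Fin N) (Fin N)).reindex (Equiv.sigmaEquivProd S (Fin N × Fin N)))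
        ((Pi.basis fun _ : S => Matrix.stdBasis ℂ (Fin N) (Fin N)).reindex (Equiv.sigmaEquivProd S (Fin N × Fin N))) (T u) p q -
      LinearMap.toMatrix
        ((Pi.basis fun _ : S => Matrix.stdBasis ℂ (Fin N) (Fin N)).reindex (Equiv.sigmaEquivProd S (Fin N × Fin N)))
        ((Pi.basis fun _ : S => Matrix.stdBasis ℂ (Fin N) (Fin N)).reindex (Equiv.sigmaEquivProd S (Fin N × Fin N))) (T 0) p q := by
    intro p q; rw [map_sub, Matrix.sub_apply]
  have hrow : ∀ p, ∑ q, ‖LinearMap.toMatrix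
        ((Pi.basis fun _ : S => Matrix.stdBasis ℂ (Fin N) (Fin N)).reindex (Equiv.sigmaEquivProd S (Fin N × Fin N)))
        ((Pi.basis fun _ : S => Matrix.stdBasis ℂ (Fin N) (Fin N)).reindex (Equiv.sigmaEquivProd S (Fin N × Fin N))) (T u - T 0) p q‖ ≤
      2 * (B * (mF * B6.c0 1 ρ ^ ν)) * R' / R := by
    intro p
    calc _ ≤ ∑ q, 2 * (B * Real.exp (-(ρ * tdist1 Nf (loc p) (loc q)))) * R' / R :=
          Finset.sum_le_sum fun q _ => by rw [hmat]; exact hdev p q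
      _ = 2 * (∑ q, B * Real.exp (-(ρ * tdist1 Nf (loc p) (loc q)))) * R' / R := by rw [Finset.mul_sum, Finset.sum_mul, Finset.sum_div]
      _ ≤ 2 * (B * (mF * B6.c0 1 ρ ^ ν)) * R' / R := by
          refine div_le_div_of_nonneg_right ?_ hR0
          exact mul_le_mul_of_nonneg_right (mul_le_mul_of_nonneg_left
            (rowSum_decay_le hA.B_nonneg hfib (fun a => rowSum_torus Nf hρ a) p) (by norm_num)) hR'
  have hcol : ∀ q, ∑ p, ‖LinearMap.toMatrix
        ((Pi.basis fun _ : S => Matrix.stdBasis ℂ (Fin N) (Fin N)).reindex (Equiv.sigmaEquivProd S (Fin N × Fin N)))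
        ((Pi.basis fun _ : S => Matrix.stdBasis ℂ (Fin N) (Fin N)).reindex (Equiv.sigmaEquivProd S (Fin N × Fin N))) (T u - T 0) p q‖ ≤
      2 * (B * (mF * B6.c0 1 ρ ^ ν)) * R' / R := by
    intro q
    calc _ ≤ ∑ p, 2 * (B * Real.exp (-(ρ * tdist1 Nf (loc p) (loc q)))) * R' / R :=
          Finset.sum_le_sum fun p _ => by rw [hmat]; exact hdev p q
      _ = 2 * (∑ p, B * Real.exp (-(ρ * tdist1 Nf (loc p) (loc q)))) * R' / R := by rw [Finset.mul_sum, Finset.sum_mul, Finset.sum_div]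
      _ ≤ 2 * (B * (mF * B6.c0 1 ρ ^ ν)) * R' / R := by
          refine div_le_div_of_nonneg_right ?_ hR0
          exact mul_le_mul_of_nonneg_right (mul_le_mul_of_nonneg_left
            (colSum_decay_le hA.B_nonneg hfib (fun a => rowSum_torus Nf hρ a) q) (by norm_num)) hR'
  exact coer_of_coer_of_rowSum_colSum (T u) (T 0) hℓ hco hrow hcol Ψ

/-- ★★ **… HENCE THEOREM 3.11's CLAUSE ON THE LOCATED BALL**: under the same letters, if `0 < m` and `2·(B·(m_F·c₀(1,ρ)^ν))·R′ < m·R` then `PosDefTr 1 (T u)` for every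
`‖u‖ < R′`. [cite: Balaban1985BackgroundPropagators, Thm 3.4 p.400, Thm 3.11 p.416; Balaban1988RG2Cluster, p.15] -/
theorem posDefTr_ball_of_coer_centre_letters (T : E → Module.End ℂ (S → Matrix (Fin N) (Fin N) ℂ)) {loc : S × (Fin N × Fin N) → UT Nf} {R R' ρ B m : ℝ}
    (hA : RawEntryLetters (fun u => LinearMap.toMatrix
        ((Pi.basis fun _ : S => Matrix.stdBasis ℂ (Fin N) (Fin N)).reindex (Equiv.sigmaEquivProd S (Fin N × Fin N)))
        ((Pi.basis fun _ : S => Matrix.stdBasis ℂ (Fin N) (Fin N)).reindex (Equiv.sigmaEquivProd S (Fin N × Fin N))) (T u)) loc R ρ B)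
    (hρ : 0 < ρ) {mF : ℕ} (hfib : ∀ y : UT Nf, (univ.filter fun k => loc k = y).card ≤ mF)
    (hco : ∀ Ψ : S → Matrix (Fin N) (Fin N) ℂ, m * trIP (fun _ => (1 : ℝ)) Ψ Ψ ≤ trIP (fun _ => (1 : ℝ)) Ψ (T 0 Ψ))
    (hR' : 0 ≤ R') (hR'R : R' ≤ R) (hsmall : 2 * (B * (mF * B6.c0 1 ρ ^ ν)) * R' < m * R) :
    ∀ u ∈ ball (0 : E) R', PosDefTr (fun _ => (1 : ℝ)) (T u) := by
  intro u hu
  have hR : 0 < R := by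
    rcases (hR'.trans hR'R).eq_or_lt with h0 | hpos
    · exfalso
      have hR'0 : R' = 0 := le_antisymm (h0 ▸ hR'R) hR'
      have : u ∈ ball (0 : E) 0 := hR'0 ▸ hu
      simp at this
    · exact hpos
  have hm' : 0 < m - 2 * (B * (mF * B6.c0 1 ρ ^ ν)) * R' / R := by
    rw [sub_pos, div_lt_iff₀ hR]; linarith
  exact posDefTr_one_of_coer (T u) hm' (coer_ball_of_coer_centre_letters T hA hρ hfib hco hR' hR'R u hu)

end Ball

/-! ## §4. ★★★ NODE 00's `Δ_a` along pv27's pencil: Theorem 3.11's clause on the located ball around a coercive background -/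

section Pencil

variable {d ℓ : ℕ} {hd : 1 ≤ d + 1} {hL : Odd (ℓ + 1) ∧ 1 < ℓ + 1} {b₀ b₁ : ℝ}
variable (i : KIdx d ℓ hd hL b₀ b₁) {N : ℕ} {G : Subgroup (Matrix (Fin N) (Fin N) ℂ)ˣ}
variable {ν : ℕ} {Nf : Fin ν → ℕ} [∀ j, NeZero (Nf j)]

/-- ★★★ **COERCIVITY OF `Δ_a` ALONG THE PENCIL FROM THE CENTRE** (ANY letters `parS parB Gp`, ANY background `U₀`): Δ_a's pencil letters
`hA : RawEntryLetters (A′ ↦ toMatrix B′ B′ (Δ_a(e^{iηA′}U₀))) loc R ρ B_Δ` (`0 < ρ`), a fibre bound `m_F`, the centre's coercivity `m·⟨Ψ,Ψ⟩₁ ≤ ⟨Ψ, Δ_a(U₀)Ψ⟩₁`,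
`0 ≤ R′ ≤ R` ⟹ for every `‖A′‖ < R′`: `(m − 2·(B_Δ·(m_F·c₀(1,ρ)^ν))·R′∕R)·⟨Ψ,Ψ⟩₁ ≤ ⟨Ψ, Δ_a(e^{iηA′}U₀)Ψ⟩₁`.
[cite: Balaban1985BackgroundPropagators, (3.26) p.395, Thm 3.4 p.400, (3.62)–(3.64) p.402, Thm 3.10 (3.108) p.416, Thm 3.11 p.416; Balaban1988RG2Cluster, p.15;
Balaban1984PropagatorsII, Lemma 2.1 (2.61) p.234] -/
theorem trIP_deltaAY_prodCfg_ge_of_coer_centre (parS : SiteParY (Matrix (Fin N) (Fin N) ℂ) i)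
    (parB : BondParY (Matrix (Fin N) (Fin N) ℂ) i) (Gp : SiteOpY (Matrix (Fin N) (Fin N) ℂ) i) (U₀ : CfgY (Matrix (Fin N) (Fin N) ℂ) i) (η : ℝ)
    {loc : FBondY i × (Fin N × Fin N) → UT Nf} {R R' ρ BΔ m : ℝ}
    (hA : RawEntryLetters (fun a : Fin (d + 1) → Site (PV d ℓ i.m i.K hd hL) 0 → Matrix (Fin N) (Fin N) ℂ =>
      LinearMap.toMatrix
        ((Pi.basis fun _ : FBondY i => Matrix.stdBasis ℂ (Fin N) (Fin N)).reindex (Equiv.sigmaEquivProd (FBondY i) (Fin N × Fin N)))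
        ((Pi.basis fun _ : FBondY i => Matrix.stdBasis ℂ (Fin N) (Fin N)).reindex (Equiv.sigmaEquivProd (FBondY i) (Fin N × Fin N)))
        (deltaAY i parS parB Gp (prodCfg U₀ η a))) loc R ρ BΔ)
    (hρ : 0 < ρ) {mF : ℕ} (hfib : ∀ y : UT Nf, (univ.filter fun k => loc k = y).card ≤ mF)
    (hco : ∀ Ψ : FBondY i → Matrix (Fin N) (Fin N) ℂ, m * trIP (fun _ => (1 : ℝ)) Ψ Ψ ≤ trIP (fun _ => (1 : ℝ)) Ψ (deltaAY i parS parB Gp U₀ Ψ))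
    (hR' : 0 ≤ R') (hR'R : R' ≤ R) :
    ∀ a ∈ ball (0 : Fin (d + 1) → Site (PV d ℓ i.m i.K hd hL) 0 → Matrix (Fin N) (Fin N) ℂ) R', ∀ Ψ : FBondY i → Matrix (Fin N) (Fin N) ℂ,
      (m - 2 * (BΔ * (mF * B6.c0 1 ρ ^ ν)) * R' / R) * trIP (fun _ => (1 : ℝ)) Ψ Ψ ≤
        trIP (fun _ => (1 : ℝ)) Ψ (deltaAY i parS parB Gp (prodCfg U₀ η a) Ψ) := by
  have hco0 : ∀ Ψ : FBondY i → Matrix (Fin N) (Fin N) ℂ,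
      m * trIP (fun _ => (1 : ℝ)) Ψ Ψ ≤ trIP (fun _ => (1 : ℝ)) Ψ (deltaAY i parS parB Gp (prodCfg U₀ η 0) Ψ) := by
    intro Ψ; rw [prodCfg_zero]; exact hco Ψ
  exact coer_ball_of_coer_centre_letters (fun a => deltaAY i parS parB Gp (prodCfg U₀ η a)) hA hρ hfib hco0 hR' hR'R

/-- ★★★ **THEOREM 3.11's CLAUSE FOR `Δ_a` ON THE LOCATED BALL AROUND A COERCIVE BACKGROUND**: under the same inputs with `0 < m` and
`2·(B_Δ·(m_F·c₀(1,ρ)^ν))·R′ < m·R`, `PosDefTr 1 (Δ_a(e^{iηA′}U₀))` for every `‖A′‖ < R′` — an OPEN inhabitant class of the N06 certificate's row-17 clause around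
every coercive centre (at `U₀ = 1`: n06-j's `exists_coer_deltaAY_parSymY_one`). [cite: Balaban1985BackgroundPropagators, Thm 3.4 p.400, Thm 3.11 p.416; Balaban1988RG2Cluster, p.15] -/
theorem posDefTr_deltaAY_prodCfg_of_coer_centre (parS : SiteParY (Matrix (Fin N) (Fin N) ℂ) i)
    (parB : BondParY (Matrix (Fin N) (Fin N) ℂ) i) (Gp : SiteOpY (Matrix (Fin N) (Fin N) ℂ) i) (U₀ : CfgY (Matrix (Fin N) (Fin N) ℂ) i) (η : ℝ)
    {loc : FBondY i × (Fin N × Fin N) → UT Nf} {R R' ρ BΔ m : ℝ}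
    (hA : RawEntryLetters (fun a : Fin (d + 1) → Site (PV d ℓ i.m i.K hd hL) 0 → Matrix (Fin N) (Fin N) ℂ =>
      LinearMap.toMatrix
        ((Pi.basis fun _ : FBondY i => Matrix.stdBasis ℂ (Fin N) (Fin N)).reindex (Equiv.sigmaEquivProd (FBondY i) (Fin N × Fin N)))
        ((Pi.basis fun _ : FBondY i => Matrix.stdBasis ℂ (Fin N) (Fin N)).reindex (Equiv.sigmaEquivProd (FBondY i) (Fin N × Fin N)))
        (deltaAY i parS parB Gp (prodCfg U₀ η a))) loc R ρ BΔ)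
    (hρ : 0 < ρ) {mF : ℕ} (hfib : ∀ y : UT Nf, (univ.filter fun k => loc k = y).card ≤ mF) (hm : 0 < m)
    (hco : ∀ Ψ : FBondY i → Matrix (Fin N) (Fin N) ℂ, m * trIP (fun _ => (1 : ℝ)) Ψ Ψ ≤ trIP (fun _ => (1 : ℝ)) Ψ (deltaAY i parS parB Gp U₀ Ψ))
    (hR' : 0 ≤ R') (hR'R : R' ≤ R) (hsmall : 2 * (BΔ * (mF * B6.c0 1 ρ ^ ν)) * R' < m * R) :
    ∀ a ∈ ball (0 : Fin (d + 1) → Site (PV d ℓ i.m i.K hd hL) 0 → Matrix (Fin N) (Fin N) ℂ) R',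
      PosDefTr (fun _ => (1 : ℝ)) (deltaAY i parS parB Gp (prodCfg U₀ η a)) := by
  have hco0 : ∀ Ψ : FBondY i → Matrix (Fin N) (Fin N) ℂ,
      m * trIP (fun _ => (1 : ℝ)) Ψ Ψ ≤ trIP (fun _ => (1 : ℝ)) Ψ (deltaAY i parS parB Gp (prodCfg U₀ η 0) Ψ) := by
    intro Ψ; rw [prodCfg_zero]; exact hco Ψ
  have _ := hm
  exact posDefTr_ball_of_coer_centre_letters (fun a => deltaAY i parS parB Gp (prodCfg U₀ η a)) hA hρ hfib hco0 hR' hR'R hsmall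

/-- ★★★ **… AND ON THE GAUGE ORBIT OF THAT BALL** (v4 letters `parSymY ∕ parBY ∕ G′ = GpY parSymY`): for every unitary-valued gauge transformation `u` and every
`‖A′‖ < R′` in the located ball, `PosDefTr 1 (Δ_a((e^{iηA′}U₀)^u))` — (3.34) through n06-j's `posDefTr_deltaAY_parSymY_gaugeY_iff`: Theorem 3.11's clause holds on
an OPEN GAUGE-INVARIANT class of backgrounds around the orbit of any coercive centre (the pure-gauge orbit of the tree being the case `U₀ = 1`, `A′ = 0`).
[cite: Balaban1985BackgroundPropagators, (3.34) p.396, (3.35) p.396, Thm 3.4 p.400, Thm 3.11 p.416; Balaban1988RG2Cluster, p.15] -/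
theorem posDefTr_deltaAY_parSymY_gaugeY_prodCfg_of_coer_centre (U₀ : CfgY (Matrix (Fin N) (Fin N) ℂ) i) (η : ℝ)
    {loc : FBondY i × (Fin N × Fin N) → UT Nf} {R R' ρ BΔ m : ℝ}
    (hA : RawEntryLetters (fun a : Fin (d + 1) → Site (PV d ℓ i.m i.K hd hL) 0 → Matrix (Fin N) (Fin N) ℂ =>
      LinearMap.toMatrix
        ((Pi.basis fun _ : FBondY i => Matrix.stdBasis ℂ (Fin N) (Fin N)).reindex (Equiv.sigmaEquivProd (FBondY i) (Fin N × Fin N)))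
        ((Pi.basis fun _ : FBondY i => Matrix.stdBasis ℂ (Fin N) (Fin N)).reindex (Equiv.sigmaEquivProd (FBondY i) (Fin N × Fin N)))
        (deltaAY i (parSymY i) (parBY i) (GpY i (parSymY i)) (prodCfg U₀ η a))) loc R ρ BΔ)
    (hρ : 0 < ρ) {mF : ℕ} (hfib : ∀ y : UT Nf, (univ.filter fun k => loc k = y).card ≤ mF) (hm : 0 < m)
    (hco : ∀ Ψ : FBondY i → Matrix (Fin N) (Fin N) ℂ,
      m * trIP (fun _ => (1 : ℝ)) Ψ Ψ ≤ trIP (fun _ => (1 : ℝ)) Ψ (deltaAY i (parSymY i) (parBY i) (GpY i (parSymY i)) U₀ Ψ))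
    (hR' : 0 ≤ R') (hR'R : R' ≤ R) (hsmall : 2 * (BΔ * (mF * B6.c0 1 ρ ^ ν)) * R' < m * R)
    {u : GaugeY (Matrix (Fin N) (Fin N) ℂ) i} (hu : ∀ x, ((u x : (Matrix (Fin N) (Fin N) ℂ)ˣ) : Matrix (Fin N) (Fin N) ℂ) ∈ unitary _) :
    ∀ a ∈ ball (0 : Fin (d + 1) → Site (PV d ℓ i.m i.K hd hL) 0 → Matrix (Fin N) (Fin N) ℂ) R',
      PosDefTr (fun _ => (1 : ℝ)) (deltaAY i (parSymY i) (parBY i) (GpY i (parSymY i)) (gaugeY i u (prodCfg U₀ η a))) :=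
  fun a ha => (B9Thm311DeltaAGaugeOrbit.posDefTr_deltaAY_parSymY_gaugeY_iff i hu _).mpr
    (posDefTr_deltaAY_prodCfg_of_coer_centre i (parSymY i) (parBY i) (GpY i (parSymY i)) U₀ η hA hρ hfib hm hco hR' hR'R hsmall a ha)

/-- ★★★ **… FROM PRINT's TWO STATEMENTS AT ONE BACKGROUND** (v4 letters `parSymY ∕ parBY ∕ G′ = GpY parSymY`, `G ≤ U(N)`, `G`-valued `U₀`): Theorem 3.11's clause
`PosDefTr 1 (Δ_a(U₀))` and Theorem 3.3's (3.46)–(3.47) form bound `⟨Φ, G(U₀)Φ⟩₁ ≤ B·⟨Φ,Φ⟩₁` (`0 < B`) at the centre — module 82's `hco` with `m = B⁻¹` — together with Δ_a's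
pencil letters and a fibre bound give the clause `PosDefTr 1 (Δ_a(e^{iηA′}U₀))` for every `‖A′‖ < R′`, `2·(B_Δ·(m_F·c₀(1,ρ)^ν))·R′ < B⁻¹·R`.
[cite: Balaban1985BackgroundPropagators, (3.26)–(3.27) p.395, (3.46)–(3.47) p.398, Thm 3.3 p.399, Thm 3.4 p.400, Thm 3.11 p.416; Balaban1988RG2Cluster, p.15] -/
theorem posDefTr_deltaAY_parSymY_prodCfg_of_posDefTr_of_GAY_formBound
    (hG : G ≤ B7Prop2Explicit.unitaryUnits (Matrix (Fin N) (Fin N) ℂ))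
    {U₀ : CfgY (Matrix (Fin N) (Fin N) ℂ) i} (hU : ∀ μ x, U₀ μ x ∈ G) (η : ℝ)
    {loc : FBondY i × (Fin N × Fin N) → UT Nf} {R R' ρ BΔ : ℝ}
    (hA : RawEntryLetters (fun a : Fin (d + 1) → Site (PV d ℓ i.m i.K hd hL) 0 → Matrix (Fin N) (Fin N) ℂ =>
      LinearMap.toMatrix
        ((Pi.basis fun _ : FBondY i => Matrix.stdBasis ℂ (Fin N) (Fin N)).reindex (Equiv.sigmaEquivProd (FBondY i) (Fin N × Fin N)))
        ((Pi.basis fun _ : FBondY i => Matrix.stdBasis ℂ (Fin N) (Fin N)).reindex (Equiv.sigmaEquivProd (FBondY i) (Fin N × Fin N)))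
        (deltaAY i (parSymY i) (parBY i) (GpY i (parSymY i)) (prodCfg U₀ η a))) loc R ρ BΔ)
    (hρ : 0 < ρ) {mF : ℕ} (hfib : ∀ y : UT Nf, (univ.filter fun k => loc k = y).card ≤ mF)
    -- print's two statements at the centre: Theorem 3.11's clause and Theorem 3.3's (3.46)–(3.47) for `G`
    (hpd : PosDefTr (fun _ => (1 : ℝ)) (deltaAY i (parSymY i) (parBY i) (GpY i (parSymY i)) U₀))
    {B : ℝ} (hB : 0 < B)
    (hGB : ∀ Φ : FBondY i → Matrix (Fin N) (Fin N) ℂ,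
      trIP (fun _ => (1 : ℝ)) Φ (GAY i (parSymY i) (parBY i) (GpY i (parSymY i)) U₀ Φ) ≤ B * trIP (fun _ => (1 : ℝ)) Φ Φ)
    (hR' : 0 ≤ R') (hR'R : R' ≤ R) (hsmall : 2 * (BΔ * (mF * B6.c0 1 ρ ^ ν)) * R' < B⁻¹ * R) :
    ∀ a ∈ ball (0 : Fin (d + 1) → Site (PV d ℓ i.m i.K hd hL) 0 → Matrix (Fin N) (Fin N) ℂ) R',
      PosDefTr (fun _ => (1 : ℝ)) (deltaAY i (parSymY i) (parBY i) (GpY i (parSymY i)) (prodCfg U₀ η a)) :=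
  posDefTr_deltaAY_prodCfg_of_coer_centre i (parSymY i) (parBY i) (GpY i (parSymY i)) U₀ η hA hρ hfib (inv_pos.mpr hB)
    (trIP_deltaAY_parSymY_ge_of_posDefTr_of_GAY_formBound i hG hU hpd hB hGB) hR' hR'R hsmall

end Pencil

end Literature.MathematicalPhysics.QuantumFieldTheory.Balaban1983to89.B13CoerciveAlongPencil

end
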